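import Summits.CriticalPhenomena.Ising3D.TaylorRegionQPoly
import Literature.MathematicalPhysics.QuantumFieldTheory.ConformalBootstrap3D.RadialConversion
import Literature.Analysis.ValidatedNumerics.BoxCover
import Mathlib.Algebra.BigOperators.NatAntidiagonal
import Mathlib.Tactic.Linarith
import Mathlib.Tactic.Positivity
import Mathlib.Tactic.Ring
import HarnessLib

/-!
# The TABLE layer of a derivative certificate, I: the q-polynomial closed forms as `ArithExpr`s
(cell `pub-ising3x`, seat boot-1 gen 6; gate (g2) of the M3-γ milestone — the rational table theorem)

HONEST FRAMING: lottery ticket; floor = tightest certified 3D Ising CFT bounds; no exact-solution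
claim without a proof.

Design of the (g2) TABLE theorem ("POLYBOX"): every obligation of `TaylorConeObligations` for the
concrete functional `taylorCrossing ½ ½ S w` with RATIONAL weights is the sign of a rational-coefficient
POLYNOMIAL in finitely many real variables — the external dimensions `(Δσ, Δε)`, a cell variable
(`Δ` or `E`), and ENCLOSURE VARIABLES standing for the non-polynomial quantities (the powers
`(½)^{linear}`, the block coefficients `hrCoeff`/`hrCoeffAB`), each ranging over a rational interval —
on a rational box. Such a claim is exactly a `BoxBoundClaim` of the tree's validated-numerics layer
(`Literature.Analysis.ValidatedNumerics`: `ArithExpr`, its natural interval extension `enclose` with the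
inclusion theorem, kd-tree certificates `KdCert` with `KdCert.sound`), so the table theorem needs no new
arithmetic engine: it needs the closed forms of `TaylorCoeffZMonoHalf` / `TaylorRegionQPoly` as
`ArithExpr`s with evaluation theorems. This file supplies them:

* `sumRangeExpr n f` (`Σ_{k<n} f k`), `chooseExpr e n` (`Ring.choose (eval e) n`, by the ratio recurrence
  `ring_choose_succ`), `qFactor₁Expr`, `qFactor₂Expr` (`eval = qFactor₁/₂`), `legendreLamQ'` (`λ_p` as a
  rational), `qSumExpr c L es σ eE j` (`eval = qSum (c ·) L.toFinset (eval es) σ (eval eE) j` for a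
  duplicate-free index list `L`);
* the generic positivity transfer `pos_of_kdCheck_neg` (`KdCert` check of `-e ≤ b` with `b < 0` gives
  `0 < eval e` on the box).

Elementary (interval arithmetic, Moore 1966; the closed forms are the tree's).
-/

namespace Summit.CriticalPhenomena.Ising3D

open Finset
open Literature.MathematicalPhysics.QuantumFieldTheory.ConformalBootstrap3D
open Literature.Analysis.ValidatedNumerics

/-! ### Finite sums and generalised binomial coefficients as expressions -/

/-- `Σ_{k < n} f k` as an expression. [folklore] -/
def sumRangeExpr : ℕ → (ℕ → ArithExpr) → ArithExpr
  | 0, _ => .const 0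
  | n + 1, f => .add (sumRangeExpr n f) (f n)

/-- Evaluation of `sumRangeExpr`. [folklore] -/
theorem eval_sumRangeExpr (x : ℕ → ℝ) (f : ℕ → ArithExpr) :
    ∀ n : ℕ, (sumRangeExpr n f).eval x = ∑ k ∈ range n, (f k).eval x
  | 0 => by simp [sumRangeExpr]
  | n + 1 => by rw [sumRangeExpr, ArithExpr.eval_add, eval_sumRangeExpr x f n, sum_range_succ]

/-- `Σ_{e ∈ l} e` as an expression (list fold). [folklore] -/
def sumListExpr : List ArithExpr → ArithExpr
  | [] => .const 0
  | e :: l => .add e (sumListExpr l)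

/-- Evaluation of `sumListExpr`. [folklore] -/
theorem eval_sumListExpr (x : ℕ → ℝ) : ∀ l : List ArithExpr, (sumListExpr l).eval x = (l.map (ArithExpr.eval x)).sum
  | [] => by simp [sumListExpr]
  | e :: l => by rw [sumListExpr, ArithExpr.eval_add, eval_sumListExpr x l, List.map_cons, List.sum_cons]

/-- The generalised binomial coefficient `C(e, n)` as an expression, by the ratio recurrence
`C(r, n+1) = C(r, n) (r - n)/(n+1)`. [folklore] -/
def chooseExpr (e : ArithExpr) : ℕ → ArithExpr
  | 0 => .const 1
  | n + 1 => .mul (chooseExpr e n) (.mul (.sub e (.const n)) (.const (1 / ((n : ℚ) + 1))))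

/-- `eval (chooseExpr e n) = Ring.choose (eval e) n`. [folklore] -/
theorem eval_chooseExpr (x : ℕ → ℝ) (e : ArithExpr) :
    ∀ n : ℕ, (chooseExpr e n).eval x = Ring.choose (e.eval x) n
  | 0 => by simp [chooseExpr]
  | n + 1 => by
    rw [chooseExpr, ArithExpr.eval_mul, ArithExpr.eval_mul, ArithExpr.eval_sub, eval_chooseExpr x e n,
      ring_choose_succ, ArithExpr.eval_const, ArithExpr.eval_const]
    have h : ((n : ℝ) + 1) ≠ 0 := by positivity
    push_cast
    field_simp

/-- `q¹(s, α; a) = Σ_{i+i'=a} (-1)^i C(s,i) C(α,i')` as an expression in the expressions `es, eα`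
for `s, α`. [folklore] -/
def qFactor₁Expr (es eα : ArithExpr) (a : ℕ) : ArithExpr :=
  sumRangeExpr (a + 1) fun i => .mul (.const ((-1) ^ i)) (.mul (chooseExpr es i) (chooseExpr eα (a - i)))

/-- `eval (qFactor₁Expr es eα a) = qFactor₁ (eval es) (eval eα) a`. [folklore] -/
theorem eval_qFactor₁Expr (x : ℕ → ℝ) (es eα : ArithExpr) (a : ℕ) :
    (qFactor₁Expr es eα a).eval x = qFactor₁ (es.eval x) (eα.eval x) a := by
  rw [qFactor₁Expr, eval_sumRangeExpr, qFactor₁,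
    Nat.sum_antidiagonal_eq_sum_range_succ (fun i j => (-1 : ℝ) ^ i * Ring.choose (es.eval x) i *
      Ring.choose (eα.eval x) j) a]
  refine sum_congr rfl fun k _ => ?_
  simp only [ArithExpr.eval_mul, ArithExpr.eval_const, eval_chooseExpr]
  push_cast
  ring

/-- `q²(s, α; a) = Σ_{i+i'=a} C(s,i) (-1)^{i'} C(α,i')` as an expression. [folklore] -/
def qFactor₂Expr (es eα : ArithExpr) (a : ℕ) : ArithExpr :=
  sumRangeExpr (a + 1) fun i => .mul (.const ((-1) ^ (a - i))) (.mul (chooseExpr es i) (chooseExpr eα (a - i)))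

/-- `eval (qFactor₂Expr es eα a) = qFactor₂ (eval es) (eval eα) a`. [folklore] -/
theorem eval_qFactor₂Expr (x : ℕ → ℝ) (es eα : ArithExpr) (a : ℕ) :
    (qFactor₂Expr es eα a).eval x = qFactor₂ (es.eval x) (eα.eval x) a := by
  rw [qFactor₂Expr, eval_sumRangeExpr, qFactor₂,
    Nat.sum_antidiagonal_eq_sum_range_succ (fun i j => Ring.choose (es.eval x) i *
      ((-1 : ℝ) ^ j * Ring.choose (eα.eval x) j)) a]
  refine sum_congr rfl fun k _ => ?_
  simp only [ArithExpr.eval_mul, ArithExpr.eval_const, eval_chooseExpr]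
  push_cast
  ring

/-! ### The weighted q-sum as an expression -/

/-- `λ_p = C(2p,p)/4^p` as a rational number. [folklore] -/
def legendreLamQ' (p : ℕ) : ℚ := (Nat.centralBinom p : ℚ) / 4 ^ p

/-- `(legendreLamQ' p : ℝ) = legendreLam p`. [folklore] -/
theorem cast_legendreLamQ' (p : ℕ) : ((legendreLamQ' p : ℚ) : ℝ) = legendreLam p := by
  simp [legendreLamQ', legendreLam]

/-- The expression `(eE - j)/2 + p` for `τ + p`, `τ = (E - j)/2`. [folklore] -/
def tauExpr (eE : ArithExpr) (j p : ℕ) : ArithExpr :=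
  .add (.mul (.sub eE (.const j)) (.const (1 / 2))) (.const p)

/-- Evaluation of `tauExpr`. [folklore] -/
theorem eval_tauExpr (x : ℕ → ℝ) (eE : ArithExpr) (j p : ℕ) :
    (tauExpr eE j p).eval x = (eE.eval x - (j : ℝ)) / 2 + (p : ℝ) := by
  simp only [tauExpr, ArithExpr.eval_add, ArithExpr.eval_mul, ArithExpr.eval_sub, ArithExpr.eval_const]
  push_cast
  ring

/-- The inner antidiagonal sum of `qSum` at `(a, b)`:
`Σ_{p₁+p₂=j} λ_{p₁}λ_{p₂} (q¹(s,τ+p₁;a) q¹(s,τ+p₂;b) + σ q²(s,τ+p₁;a) q²(s,τ+p₂;b))`. [folklore] -/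
def qInnerExpr (es : ArithExpr) (σ : ℚ) (eE : ArithExpr) (j a b : ℕ) : ArithExpr :=
  sumRangeExpr (j + 1) fun p =>
    .mul (.const (legendreLamQ' p * legendreLamQ' (j - p)))
      (.add (.mul (qFactor₁Expr es (tauExpr eE j p) a) (qFactor₁Expr es (tauExpr eE j (j - p)) b))
        (.mul (.const σ) (.mul (qFactor₂Expr es (tauExpr eE j p) a) (qFactor₂Expr es (tauExpr eE j (j - p)) b))))

/-- Evaluation of `qInnerExpr`. [folklore] -/
theorem eval_qInnerExpr (x : ℕ → ℝ) (es : ArithExpr) (σ : ℚ) (eE : ArithExpr) (j a b : ℕ) :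
    (qInnerExpr es σ eE j a b).eval x =
      ∑ p ∈ antidiagonal j, legendreLam p.1 * legendreLam p.2 *
        (qFactor₁ (es.eval x) ((eE.eval x - (j : ℝ)) / 2 + p.1) a *
            qFactor₁ (es.eval x) ((eE.eval x - (j : ℝ)) / 2 + p.2) b +
          (σ : ℝ) * (qFactor₂ (es.eval x) ((eE.eval x - (j : ℝ)) / 2 + p.1) a *
            qFactor₂ (es.eval x) ((eE.eval x - (j : ℝ)) / 2 + p.2) b)) := by
  rw [qInnerExpr, eval_sumRangeExpr,
    Nat.sum_antidiagonal_eq_sum_range_succ (fun p₁ p₂ => legendreLam p₁ * legendreLam p₂ *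
        (qFactor₁ (es.eval x) ((eE.eval x - (j : ℝ)) / 2 + p₁) a *
            qFactor₁ (es.eval x) ((eE.eval x - (j : ℝ)) / 2 + p₂) b +
          (σ : ℝ) * (qFactor₂ (es.eval x) ((eE.eval x - (j : ℝ)) / 2 + p₁) a *
            qFactor₂ (es.eval x) ((eE.eval x - (j : ℝ)) / 2 + p₂) b))) j]
  refine sum_congr rfl fun k hk => ?_
  simp only [ArithExpr.eval_mul, ArithExpr.eval_add, ArithExpr.eval_const, eval_qFactor₁Expr,
    eval_qFactor₂Expr, eval_tauExpr]
  have hkj : k ≤ j := Nat.lt_succ_iff.mp (mem_range.mp hk)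
  push_cast [hkj, cast_legendreLamQ']
  ring

/-- **The weighted q-sum as an expression**: for rational weights `c` on a duplicate-free index list
`L`, `qSumExpr c L es σ eE j` evaluates to `qSum c L.toFinset s σ E j` at `s = eval es`, `E = eval eE`.
[folklore] -/
def qSumExpr (c : ℕ × ℕ → ℚ) (L : List (ℕ × ℕ)) (es : ArithExpr) (σ : ℚ) (eE : ArithExpr) (j : ℕ) :
    ArithExpr :=
  sumListExpr (L.map fun ab => .mul (.const (c ab * 2 ^ (ab.1 + ab.2))) (qInnerExpr es σ eE j ab.1 ab.2))

/-- Evaluation of `qSumExpr`. [folklore] -/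
theorem eval_qSumExpr (x : ℕ → ℝ) (c : ℕ × ℕ → ℚ) {L : List (ℕ × ℕ)} (hL : L.Nodup) (es : ArithExpr)
    (σ : ℚ) (eE : ArithExpr) (j : ℕ) :
    (qSumExpr c L es σ eE j).eval x =
      qSum (fun ab => (c ab : ℝ)) L.toFinset (es.eval x) (σ : ℝ) (eE.eval x) j := by
  rw [qSumExpr, eval_sumListExpr, qSum, List.sum_toFinset _ hL, List.map_map]
  congr 1
  refine List.map_congr_left fun ab _ => ?_
  simp only [Function.comp_apply, ArithExpr.eval_mul, ArithExpr.eval_const, eval_qInnerExpr]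
  push_cast
  ring

/-! ### Positivity on a box from a kd-tree check -/

/-- **Strict positivity transfer**: if the kd-tree check of `-e ≤ b` passes on the box `B` and `b < 0`,
then `0 < eval e` at every real point of `B`. [folklore] -/
theorem pos_of_kdCheck_neg {e : ArithExpr} {b : ℚ} {B : Box} {t : KdCert ℕ}
    (h : t.check (exprLeOn (.neg e) b) B = true) (hb : b < 0) (x : ℕ → ℝ) (hx : B.mem x) :
    0 < e.eval x := by
  have h1 := eval_le_of_kdCheck h x hx
  rw [ArithExpr.eval_neg] at h1
  have : (b : ℝ) < 0 := by exact_mod_cast hb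
  linarith

/-- **Non-negativity transfer**: if the kd-tree check of `-e ≤ 0` passes on `B` then `0 ≤ eval e` on `B`.
[folklore] -/
theorem nonneg_of_kdCheck_neg {e : ArithExpr} {B : Box} {t : KdCert ℕ}
    (h : t.check (exprLeOn (.neg e) 0) B = true) (x : ℕ → ℝ) (hx : B.mem x) : 0 ≤ e.eval x := by
  have h1 := eval_le_of_kdCheck h x hx
  rw [ArithExpr.eval_neg] at h1
  push_cast at h1
  linarith

end Summit.CriticalPhenomena.Ising3D
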